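import Literature.MathematicalPhysics.QuantumLattice.TorusSectorGibbsMixture
import HarnessLib

/-!
# The linearised energy–entropy balance (Araki–Sewell) inequality for canonical Gibbs
# eigen-mixtures of a Hermitian matrix, in the full space and in an invariant coordinate sector

Topic `Literature/MathematicalPhysics/QuantumLattice` (thermal toolkit; companion of
`TorusSectorGibbsMixture.lean`, whose §1 objects `sectorEigenvector`, `sectorEigenvalue`,
`canonicalWeight` write the canonical Gibbs state of a sector as an eigen-mixture). Written for the
`T > 0` certificate family of the Hubbard programme (certified thermal windows from state relaxations
with energy–entropy-balance rows, after Fawzi–Fawzi–Scalet 2024 and Araki–Sewell 1977).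

A state `ω` of a finite quantum system with Hamiltonian `H` is the Gibbs state at inverse temperature
`β` iff it is stationary, `ω([H, a]) = 0`, and satisfies the **energy–entropy balance (EEB)
inequalities** `ω(a⋆a) log(ω(a⋆a)/ω(aa⋆)) ≤ β ω(a⋆[H, a])` for all `a` (Araki–Sewell; Fawzi–Fawzi–Scalet
Thm. 3.1; Bratteli–Robinson II Thm. 5.3.15; for lattice fermions Araki–Moriya Def. 6.3 / Thm. 6.4).
Since `x log(x/y) = sup_s (s·x − e^{s−1}·y)` (`y > 0`), the EEB inequality is equivalent to the family
of LINEAR inequalities in the moments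

  `s·ω(a⋆a) − q·ω(aa⋆) ≤ β·ω(a⋆[H, a])`,   `e^{s−1} ≤ q`,

i.e. `0 ≤ Re ω(β·a⋆(Ha − aH) − s·a⋆a + q·aa⋆)` — the rows a semidefinite relaxation can carry with
exact rational data (`s ∈ ℚ`, `q` a rational upper bound of `e^{s−1}`). This file PROVES these
linear rows directly (no logarithm, no Jensen): in the energy eigenbasis the functional is
`Σ_{a,b} |⟨v_b, a v_a⟩|² e^{−βE_a} (x − s + q e^{−x})`, `x = β(E_b − E_a)`, and
`x − s + q e^{−x} ≥ 0` is the tangent inequality `e^{s−1−x} ≥ s − x`.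

* §1 `sub_add_mul_exp_neg_nonneg_of_exp_le`: `0 ≤ x − s + q e^{−x}` for `e^{s−1} ≤ q`.
* §2 (full space) `sum_exp_mul_re_expect_eeb_nonneg`: for `H` Hermitian with Mathlib eigenbasis
  `v_a` (`eigenvectorUnitary`) and eigenvalues `E_a`, every matrix `B` and all real `β`, `s`, `q` with
  `e^{s−1} ≤ q`: `0 ≤ Σ_a e^{−βE_a} Re⟨v_a, (β·Bᴴ(HB − BH) − s·BᴴB + q·BBᴴ) v_a⟩`.
* §3 (coordinate sector `p`, the format of `TorusSectorGibbsMixture`: `A` Hermitian with no entries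
  between `p` and its complement, canonical weights `w_a = e^{−βE_a}/Z` of the compression):
  `sum_canonicalWeight_mul_re_expect_eeb_nonneg` — the same inequality for the mixture
  `(w_a, ψ_a)` = the canonical Gibbs state `tr(P_p e^{−βA} ·)/Z_p` of the sector, for every `B` such
  that `B` and `Bᴴ` map the sector into itself (for the Hubbard torus: gauge-invariant `B`; the
  canonical state is NOT a KMS state for number-changing `B`); the stationarity (equation-of-motion)
  rows `⟨ψ, (AX − XA)ψ⟩ = 0` for eigenvectors (`star_dotProduct_commutator_mulVec_eq_zero_of_eigenvector`,
  every `X`); and the bookkeeping between invariant subspaces and matrix entries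
  (`star_sectorExtend_dotProduct_mulVec_sectorExtend`, `submatrix_mul_of_apply_eq_zero_off`,
  `mul_apply_eq_zero_off`, `apply_eq_zero_off_of_mulVec_mem`).

The torus instances and the passage to torus-limit states follow in a companion file. Everything
is PROVED; no definition, no named fact. The matrix (operator-relative-entropy) form of the EEB
constraint (Fawzi–Fawzi–Scalet Thm. 3.4) is not needed for linear rows and not included.

## Mathlib / tree search

REUSED: Mathlib `Matrix.IsHermitian.eigenvectorUnitary(_apply)`, `.mulVec_eigenvectorBasis`,
`Matrix.mem_unitaryGroup_iff(')`, `Real.add_one_le_exp`, `Matrix.mulVec_single_one`; tree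
`sectorExtend`, `sectorEigenvector`, `sectorEigenvalue`, `canonicalWeight` (`TorusSectorGibbsMixture`).
`lean search 'EnergyEntropyBalance|eeb|Araki.?Sewell'`: nothing in the tree (2026-08-26); the
finite-volume KMS condition exists as `gibbsState_mul_eq_gibbsState_imagTimeEvolve_mul`
(`HubbardSchwingerFunction`) and the `T = 0` analogue of these rows (local stability of sector ground
states) as `star_dotProduct_conjTranspose_mul_commutator_mulVec_nonneg`
(`InfVolFermionStateTorusLimitLocalStability`). Presearch: corpus `paper:arxiv-2311.18706` §3.1
Thm. 3.1 (EEB ⟺ Gibbs/KMS, with the convention `x log(x/y)`), `paper:arxiv-math-ph_0211016` Def. 6.3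
(fermionic dKMS); the linear (tangent) form is Fenchel duality applied to Thm. 3.1 and is not printed
as such (hubbard-thermal THERMAL-SOURCES.md §1, "reader-friendly form").

## References

* H. Fawzi, O. Fawzi, S. O. Scalet, *Certified algorithms for equilibrium states of local quantum
  Hamiltonians*, Nat. Commun. 15 (2024) 7394 = arXiv:2311.18706, §3.1 Thm. 3.1 (EEB ⟺ KMS), §3.2
  (the relaxation with EEB constraints). [cite: FawziFawziScalet2024, Thm. 3.1]
* O. Bratteli, D. W. Robinson, *Operator Algebras and Quantum Statistical Mechanics 2*, 2nd ed.
  (1997), Thm. 5.3.15 (Araki–Sewell auto-correlation lower bound ⟺ KMS).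
  [cite: BratteliRobinsonII1997, Thm. 5.3.15]
* H. Araki, H. Moriya, *Equilibrium statistical mechanics of fermion lattice systems*, Rev. Math.
  Phys. 15 (2003) 93, Def. 6.3 and Thm. 6.4 (dKMS ⟺ KMS for the CAR algebra).
  [cite: ArakiMoriya2003, Def. 6.3]
-/

noncomputable section

namespace Literature.MathematicalPhysics.QuantumLattice

open Matrix Finset HubbardWave0 Literature.Probability.LatticeModels ThermodynamicLimit
open _root_.Filter
open scoped _root_.Topology ComplexOrder BigOperators

/-! ### §1 The tangent inequality behind the linearised energy–entropy balance -/

/-- **Tangent inequality.** For real `s, q` with `e^{s-1} ≤ q` and every real `x`: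
`0 ≤ x − s + q·e^{−x}` (since `q e^{−x} ≥ e^{s−1−x} ≥ 1 + (s − 1 − x)`). This is the pointwise
inequality that makes every linearisation `s·X − e^{s−1}·Y ≤ X log(X/Y)` of the energy–entropy
balance function a valid linear cut. [cite: FawziFawziScalet2024, Thm. 3.1] -/
theorem sub_add_mul_exp_neg_nonneg_of_exp_le {s q : ℝ} (hq : Real.exp (s - 1) ≤ q) (x : ℝ) :
    0 ≤ x - s + q * Real.exp (-x) := by
  have h1 : Real.exp (s - 1) * Real.exp (-x) ≤ q * Real.exp (-x) :=
    mul_le_mul_of_nonneg_right hq (Real.exp_pos _).le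
  have h2 : s - 1 - x + 1 ≤ Real.exp (s - 1 - x) := Real.add_one_le_exp _
  rw [← Real.exp_add, show s - 1 + -x = s - 1 - x by ring] at h1
  linarith

/-! ### §2 The linearised EEB inequality for the canonical eigen-mixture of a Hermitian matrix -/

section FullSpace

variable {κ : Type*} [Fintype κ] [DecidableEq κ]

omit [DecidableEq κ] in
/-- A diagonal entry of `Vᴴ X V` is the expectation of `X` in the corresponding column of `V`.
[folklore] -/
private theorem conjTranspose_mul_mul_apply_same (V X : Matrix κ κ ℂ) (a : κ) :
    (Vᴴ * X * V) a a = star (fun i => V i a) ⬝ᵥ (X *ᵥ fun i => V i a) := by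
  rw [Matrix.mul_assoc, Matrix.mul_apply]
  simp only [conjTranspose_apply, dotProduct, Pi.star_apply, mulVec, Matrix.mul_apply]

/-- **Linearised energy–entropy balance for the canonical eigen-mixture of a Hermitian matrix
(Boltzmann weights, unnormalised).** Let `H` be Hermitian with orthonormal eigenbasis `v_a`
(the columns of `Matrix.IsHermitian.eigenvectorUnitary`) and eigenvalues `E_a`, let `B` be any
matrix and `β, s, q` real with `e^{s−1} ≤ q`. Then
`0 ≤ Σ_a e^{−βE_a} · Re ⟨v_a, (β·Bᴴ(HB − BH) − s·BᴴB + q·BBᴴ) v_a⟩`.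
In the eigenbasis the sum is `Σ_{a,b} |⟨v_b, B v_a⟩|² e^{−βE_a} (x − s + q e^{−x})`,
`x = β(E_b − E_a)`, termwise `≥ 0` by `sub_add_mul_exp_neg_nonneg_of_exp_le`. This is the
finite-dimensional content of the Araki–Sewell energy–entropy balance inequality
`ω(A⋆A) log(ω(A⋆A)/ω(AA⋆)) ≤ β ω(A⋆[H,A])` for the Gibbs state `ω = tr(e^{−βH} ·)/Z`, linearised
(`x log(x/y) = sup_s (s x − e^{s−1} y)`). [cite: FawziFawziScalet2024, Thm. 3.1] -/
theorem sum_exp_mul_re_expect_eeb_nonneg {H : Matrix κ κ ℂ} (hH : H.IsHermitian)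
    (B : Matrix κ κ ℂ) (β : ℝ) {s q : ℝ} (hq : Real.exp (s - 1) ≤ q) :
    0 ≤ ∑ a, Real.exp (-(β * hH.eigenvalues a)) *
      (star (fun i => (hH.eigenvectorUnitary : Matrix κ κ ℂ) i a) ⬝ᵥ
        ((((β : ℝ) : ℂ) • (Bᴴ * (H * B - B * H)) - ((s : ℝ) : ℂ) • (Bᴴ * B) +
            ((q : ℝ) : ℂ) • (B * Bᴴ)) *ᵥ
          fun i => (hH.eigenvectorUnitary : Matrix κ κ ℂ) i a)).re := by
  set V : Matrix κ κ ℂ := (hH.eigenvectorUnitary : Matrix κ κ ℂ) with hV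
  set E : κ → ℝ := hH.eigenvalues with hE
  set X : Matrix κ κ ℂ := (((β : ℝ) : ℂ) • (Bᴴ * (H * B - B * H)) - ((s : ℝ) : ℂ) • (Bᴴ * B) +
    ((q : ℝ) : ℂ) • (B * Bᴴ)) with hX
  -- unitarity
  have hVV : Vᴴ * V = 1 := by
    have h := Matrix.mem_unitaryGroup_iff'.1 hH.eigenvectorUnitary.2
    rwa [Matrix.star_eq_conjTranspose] at h
  have hVV' : V * Vᴴ = 1 := by
    have h := Matrix.mem_unitaryGroup_iff.1 hH.eigenvectorUnitary.2
    rwa [Matrix.star_eq_conjTranspose] at h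
  -- `H V = V D`
  set D : Matrix κ κ ℂ := diagonal (fun b => ((E b : ℝ) : ℂ)) with hD
  have hHV : H * V = V * D := by
    ext i a
    have hcol : (fun b => V b a) = ⇑(hH.eigenvectorBasis a) := funext fun b => by
      rw [hV, Matrix.IsHermitian.eigenvectorUnitary_apply]
    have h := hH.mulVec_eigenvectorBasis a
    rw [← hcol] at h
    have hi := congrFun h i
    simp only [mulVec, dotProduct, Pi.smul_apply] at hi
    rw [hD, mul_diagonal, Matrix.mul_apply, hi, RCLike.real_smul_eq_coe_mul, mul_comm]
    rfl
  have hD' : Vᴴ * H * V = D := by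
    rw [Matrix.mul_assoc, hHV, ← Matrix.mul_assoc, hVV, Matrix.one_mul]
  -- `B` in the eigenbasis
  set C : Matrix κ κ ℂ := Vᴴ * B * V with hC
  have hCt : Cᴴ = Vᴴ * Bᴴ * V := by
    rw [hC, conjTranspose_mul, conjTranspose_mul, conjTranspose_conjTranspose, Matrix.mul_assoc]
  have hconj : ∀ Y Z : Matrix κ κ ℂ, Vᴴ * (Y * Z) * V = (Vᴴ * Y * V) * (Vᴴ * Z * V) := by
    intro Y Z
    calc Vᴴ * (Y * Z) * V = Vᴴ * (Y * (V * Vᴴ) * Z) * V := by rw [hVV', Matrix.mul_one]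
      _ = (Vᴴ * Y * V) * (Vᴴ * Z * V) := by simp only [Matrix.mul_assoc]
  have e1 : Vᴴ * (Bᴴ * (H * B)) * V = Cᴴ * (D * C) := by rw [hconj, hconj, hD', hCt, hC]
  have e2 : Vᴴ * (Bᴴ * (B * H)) * V = Cᴴ * (C * D) := by rw [hconj, hconj, hD', hCt, hC]
  have e3 : Vᴴ * (Bᴴ * B) * V = Cᴴ * C := by rw [hconj, hCt, hC]
  have e4 : Vᴴ * (B * Bᴴ) * V = C * Cᴴ := by rw [hconj, hCt, hC]
  have hXV : Vᴴ * X * V = ((β : ℝ) : ℂ) • (Cᴴ * (D * C) - Cᴴ * (C * D)) - ((s : ℝ) : ℂ) • (Cᴴ * C) +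
      ((q : ℝ) : ℂ) • (C * Cᴴ) := by
    rw [hX]
    simp only [Matrix.mul_add, Matrix.mul_sub, Matrix.add_mul, Matrix.sub_mul, Matrix.mul_smul,
      Matrix.smul_mul, smul_sub, e1, e2, e3, e4]
  -- the diagonal entries, as real numbers
  have hdiag : ∀ a, (star (fun i => V i a) ⬝ᵥ (X *ᵥ fun i => V i a)).re =
      ∑ b, Complex.normSq (C b a) * (β * (E b - E a) - s) + q * ∑ b, Complex.normSq (C a b) := by
    intro a
    have t1 : (Cᴴ * (D * C)) a a = ∑ b, ((Complex.normSq (C b a) * E b : ℝ) : ℂ) := by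
      rw [Matrix.mul_apply]
      refine Finset.sum_congr rfl fun b _ => ?_
      rw [conjTranspose_apply, hD, diagonal_mul, Complex.ofReal_mul, Complex.normSq_eq_conj_mul_self,
        Complex.star_def]
      ring
    have t2 : (Cᴴ * (C * D)) a a = ∑ b, ((Complex.normSq (C b a) * E a : ℝ) : ℂ) := by
      rw [Matrix.mul_apply]
      refine Finset.sum_congr rfl fun b _ => ?_
      rw [conjTranspose_apply, hD, mul_diagonal, Complex.ofReal_mul, Complex.normSq_eq_conj_mul_self,
        Complex.star_def]
      ring
    have t3 : (Cᴴ * C) a a = ∑ b, ((Complex.normSq (C b a) : ℝ) : ℂ) := by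
      rw [Matrix.mul_apply]
      refine Finset.sum_congr rfl fun b _ => ?_
      rw [conjTranspose_apply, Complex.normSq_eq_conj_mul_self, Complex.star_def]
    have t4 : (C * Cᴴ) a a = ∑ b, ((Complex.normSq (C a b) : ℝ) : ℂ) := by
      rw [Matrix.mul_apply]
      refine Finset.sum_congr rfl fun b _ => ?_
      rw [conjTranspose_apply, Complex.star_def, Complex.mul_conj]
    rw [← conjTranspose_mul_mul_apply_same, hXV]
    simp only [Matrix.add_apply, Matrix.sub_apply, Matrix.smul_apply, smul_eq_mul, t1, t2, t3, t4,
      ← Complex.ofReal_sum, ← Complex.ofReal_sub, ← Complex.ofReal_mul, ← Complex.ofReal_add,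
      Complex.ofReal_re]
    have hre : β * (∑ b, Complex.normSq (C b a) * E b - ∑ b, Complex.normSq (C b a) * E a) -
        s * ∑ b, Complex.normSq (C b a) = ∑ b, Complex.normSq (C b a) * (β * (E b - E a) - s) := by
      rw [← Finset.sum_sub_distrib, Finset.mul_sum, Finset.mul_sum, ← Finset.sum_sub_distrib]
      exact Finset.sum_congr rfl fun b _ => by ring
    rw [hre]
  simp_rw [hdiag]
  -- regroup: `Σ_a w_a (Σ_b N_{ba}(β(E_b-E_a)-s) + q Σ_b N_{ab}) = Σ_a Σ_b N_{ba} (w_a(β(E_b-E_a)-s) + q w_b)`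
  have hswap : ∑ a, Real.exp (-(β * E a)) * (q * ∑ b, Complex.normSq (C a b)) =
      ∑ a, ∑ b, Complex.normSq (C b a) * (q * Real.exp (-(β * E b))) := by
    rw [Finset.sum_comm]
    refine Finset.sum_congr rfl fun a _ => ?_
    rw [Finset.mul_sum, Finset.mul_sum]
    refine Finset.sum_congr rfl fun b _ => ?_
    ring
  have hsplit : ∑ a, Real.exp (-(β * E a)) *
      (∑ b, Complex.normSq (C b a) * (β * (E b - E a) - s) + q * ∑ b, Complex.normSq (C a b)) =
      ∑ a, ∑ b, Complex.normSq (C b a) *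
        (Real.exp (-(β * E a)) * (β * (E b - E a) - s) + q * Real.exp (-(β * E b))) := by
    calc ∑ a, Real.exp (-(β * E a)) *
          (∑ b, Complex.normSq (C b a) * (β * (E b - E a) - s) + q * ∑ b, Complex.normSq (C a b))
        = ∑ a, Real.exp (-(β * E a)) * (∑ b, Complex.normSq (C b a) * (β * (E b - E a) - s)) +
            ∑ a, Real.exp (-(β * E a)) * (q * ∑ b, Complex.normSq (C a b)) := by
          rw [← Finset.sum_add_distrib]
          exact Finset.sum_congr rfl fun a _ => mul_add _ _ _
      _ = ∑ a, ∑ b, Complex.normSq (C b a) * (Real.exp (-(β * E a)) * (β * (E b - E a) - s)) +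
            ∑ a, ∑ b, Complex.normSq (C b a) * (q * Real.exp (-(β * E b))) := by
          rw [hswap]
          congr 1
          refine Finset.sum_congr rfl fun a _ => ?_
          rw [Finset.mul_sum]
          exact Finset.sum_congr rfl fun b _ => by ring
      _ = ∑ a, ∑ b, Complex.normSq (C b a) *
            (Real.exp (-(β * E a)) * (β * (E b - E a) - s) + q * Real.exp (-(β * E b))) := by
          rw [← Finset.sum_add_distrib]
          refine Finset.sum_congr rfl fun a _ => ?_
          rw [← Finset.sum_add_distrib]
          exact Finset.sum_congr rfl fun b _ => by ring
  rw [hsplit]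
  refine Finset.sum_nonneg fun a _ => Finset.sum_nonneg fun b _ =>
    mul_nonneg (Complex.normSq_nonneg _) ?_
  -- `w_a (x - s) + q w_b = w_a (x - s + q e^{-x})`, `x = β (E_b - E_a)`
  have hwb : Real.exp (-(β * E b)) = Real.exp (-(β * E a)) * Real.exp (-(β * (E b - E a))) := by
    rw [← Real.exp_add]; ring_nf
  rw [hwb, show Real.exp (-(β * E a)) * (β * (E b - E a) - s) + q * (Real.exp (-(β * E a)) *
      Real.exp (-(β * (E b - E a)))) = Real.exp (-(β * E a)) * (β * (E b - E a) - s +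
        q * Real.exp (-(β * (E b - E a)))) by ring]
  exact mul_nonneg (Real.exp_pos _).le (sub_add_mul_exp_neg_nonneg_of_exp_le hq _)

end FullSpace

/-! ### §3 The same for the canonical eigen-mixture of a Hermitian matrix compressed to an
invariant coordinate sector (the format of `TorusSectorGibbsMixture`) -/

section CoordinateSector

variable {ι : Type*} [Fintype ι] [DecidableEq ι] (p : ι → Prop) [DecidablePred p]

omit [DecidableEq ι] in
/-- A sum over all coordinates of a function vanishing off the sector is the sum over the sector.
[folklore] -/
private theorem sum_eq_sum_subtype_of_eq_zero_off (f : ι → ℂ) (hf : ∀ i, ¬ p i → f i = 0) :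
    ∑ i, f i = ∑ a : Subtype p, f a.1 := by
  rw [← Finset.sum_subtype (Finset.univ.filter p) (by simp), Finset.sum_filter_of_ne]
  intro i _ hi
  by_contra h
  exact hi (hf i h)

omit [DecidableEq ι] in
/-- **Expectations in an extended sector vector only see the compression**:
`⟨ext φ, X ext φ⟩ = ⟨φ, X|_p φ⟩`, `X|_p = X.submatrix val val`, for EVERY matrix `X`. [folklore] -/
private theorem star_sectorExtend_dotProduct_mulVec_sectorExtend (X : Matrix ι ι ℂ) (φ : Subtype p → ℂ) :
    star (sectorExtend p φ) ⬝ᵥ (X *ᵥ sectorExtend p φ) =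
      star φ ⬝ᵥ (X.submatrix (Subtype.val : Subtype p → ι) Subtype.val *ᵥ φ) := by
  have hext : ∀ a : Subtype p, sectorExtend p φ a.1 = φ a := fun a => by simp [sectorExtend, a.2]
  have hoff : ∀ i, ¬ p i → sectorExtend p φ i = 0 := fun i hi => by simp [sectorExtend, hi]
  rw [dotProduct, dotProduct, sum_eq_sum_subtype_of_eq_zero_off p]
  · refine Finset.sum_congr rfl fun a _ => ?_
    rw [Pi.star_apply, Pi.star_apply, hext, mulVec, mulVec, dotProduct, dotProduct,
      sum_eq_sum_subtype_of_eq_zero_off p]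
    · simp only [Matrix.submatrix_apply, hext]
    · intro j hj
      rw [hoff j hj, mul_zero]
  · intro i hi
    rw [Pi.star_apply, hoff i hi, star_zero, zero_mul]

omit [DecidableEq ι] in
/-- If the right factor has no entries from the sector into its complement, compression is
multiplicative: `(M N)|_p = M|_p N|_p`. [folklore] -/
private theorem submatrix_mul_of_apply_eq_zero_off (M N : Matrix ι ι ℂ) (hN : ∀ i j, ¬ p i → p j → N i j = 0) :
    (M * N).submatrix (Subtype.val : Subtype p → ι) (Subtype.val : Subtype p → ι) =
      M.submatrix (Subtype.val : Subtype p → ι) (Subtype.val : Subtype p → ι) *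
        N.submatrix (Subtype.val : Subtype p → ι) (Subtype.val : Subtype p → ι) := by
  ext a b
  rw [Matrix.submatrix_apply, Matrix.mul_apply, Matrix.mul_apply, sum_eq_sum_subtype_of_eq_zero_off p]
  · rfl
  · intro k hk
    rw [hN k b.1 hk b.2, mul_zero]

omit [DecidableEq ι] in
/-- Products of sector-preserving matrices are sector preserving. [cite: Tasaki2020, §2.2] -/
theorem mul_apply_eq_zero_off {M N : Matrix ι ι ℂ} (hM : ∀ i j, ¬ p i → p j → M i j = 0)
    (hN : ∀ i j, ¬ p i → p j → N i j = 0) (i j : ι) (hi : ¬ p i) (hj : p j) : (M * N) i j = 0 := by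
  rw [Matrix.mul_apply]
  refine Finset.sum_eq_zero fun k _ => ?_
  by_cases hk : p k
  · rw [hM i k hi hk, zero_mul]
  · rw [hN k j hk hj, mul_zero]

/-- **Linearised energy–entropy balance for the canonical sector Gibbs eigen-mixture.** Let `A` be
Hermitian with no entries between the coordinate sector `p` and its complement, `ψ_a`
(`sectorEigenvector`) the extended orthonormal eigenbasis of the compression with eigenvalues `E_a`
(`sectorEigenvalue`) and canonical weights `w_a = e^{−βE_a}/Z` (`canonicalWeight`). For every
matrix `B` such that `B` and `Bᴴ` map the sector into itself and all real `s, q` with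
`e^{s−1} ≤ q`:
`0 ≤ Σ_a w_a · Re ⟨ψ_a, (β·Bᴴ(AB − BA) − s·BᴴB + q·BBᴴ) ψ_a⟩`
— the linearised EEB inequality `s·ρ(B⋆B) − q·ρ(BB⋆) ≤ β·ρ(B⋆[A,B])` for the canonical
Gibbs state `ρ = tr(P_p e^{−βA} ·)/Z_p` of the sector and the sector-preserving observable `B`
(compress to the sector, `star_sectorExtend_dotProduct_mulVec_sectorExtend`, and apply
`sum_exp_mul_re_expect_eeb_nonneg`). [cite: FawziFawziScalet2024, Thm. 3.1]
[cite: BratteliRobinsonII1997, Thm. 5.3.15] -/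
theorem sum_canonicalWeight_mul_re_expect_eeb_nonneg {A : Matrix ι ι ℂ} (hA : A.IsHermitian)
    (hinv : ∀ i j, ¬ p i → p j → A i j = 0) {B : Matrix ι ι ℂ}
    (hB : ∀ i j, ¬ p i → p j → B i j = 0) (hB' : ∀ i j, ¬ p i → p j → Bᴴ i j = 0)
    (β : ℝ) {s q : ℝ} (hq : Real.exp (s - 1) ≤ q) :
    0 ≤ ∑ a, canonicalWeight β (sectorEigenvalue p A hA) a *
      (star (sectorEigenvector p A hA a) ⬝ᵥ
        ((((β : ℝ) : ℂ) • (Bᴴ * (A * B - B * A)) - ((s : ℝ) : ℂ) • (Bᴴ * B) +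
            ((q : ℝ) : ℂ) • (B * Bᴴ)) *ᵥ sectorEigenvector p A hA a)).re := by
  set hAp := hA.submatrix (Subtype.val : Subtype p → ι) with hApdef
  set Ap : Matrix (Subtype p) (Subtype p) ℂ := A.submatrix (Subtype.val : Subtype p → ι) Subtype.val
    with hAp'
  set Bp : Matrix (Subtype p) (Subtype p) ℂ := B.submatrix (Subtype.val : Subtype p → ι) Subtype.val
    with hBp
  have hinv' : ∀ i j, ¬ p i → p j → Aᴴ i j = 0 := fun i j hi hj => by rw [hA.eq]; exact hinv i j hi hj
  -- compression of the EEB observable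
  have hBt : (Bᴴ).submatrix (Subtype.val : Subtype p → ι) Subtype.val = Bpᴴ := by
    rw [hBp, Matrix.conjTranspose_submatrix]
  have hsub : ((((β : ℝ) : ℂ) • (Bᴴ * (A * B - B * A)) - ((s : ℝ) : ℂ) • (Bᴴ * B) +
        ((q : ℝ) : ℂ) • (B * Bᴴ))).submatrix (Subtype.val : Subtype p → ι) Subtype.val =
      (((β : ℝ) : ℂ) • (Bpᴴ * (Ap * Bp - Bp * Ap)) - ((s : ℝ) : ℂ) • (Bpᴴ * Bp) +
        ((q : ℝ) : ℂ) • (Bp * Bpᴴ)) := by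
    have hAB : ∀ i j, ¬ p i → p j → (A * B - B * A) i j = 0 := fun i j hi hj => by
      rw [Matrix.sub_apply, mul_apply_eq_zero_off p hinv hB i j hi hj,
        mul_apply_eq_zero_off p hB hinv i j hi hj, sub_zero]
    simp only [Matrix.submatrix_add, Matrix.submatrix_sub, Matrix.submatrix_smul, Pi.add_apply,
      Pi.sub_apply, Pi.smul_apply, submatrix_mul_of_apply_eq_zero_off p Bᴴ (A * B - B * A) hAB,
      submatrix_mul_of_apply_eq_zero_off p A B hB, submatrix_mul_of_apply_eq_zero_off p B A hinv,
      submatrix_mul_of_apply_eq_zero_off p Bᴴ B hB, submatrix_mul_of_apply_eq_zero_off p B Bᴴ hB',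
      hBt, ← hAp', ← hBp]
  -- each term is the corresponding full-space term of the compression
  have hterm : ∀ a : Subtype p,
      (star (sectorEigenvector p A hA a) ⬝ᵥ
        ((((β : ℝ) : ℂ) • (Bᴴ * (A * B - B * A)) - ((s : ℝ) : ℂ) • (Bᴴ * B) +
            ((q : ℝ) : ℂ) • (B * Bᴴ)) *ᵥ sectorEigenvector p A hA a)) =
      star (fun b => (hAp.eigenvectorUnitary : Matrix (Subtype p) (Subtype p) ℂ) b a) ⬝ᵥ
        ((((β : ℝ) : ℂ) • (Bpᴴ * (Ap * Bp - Bp * Ap)) - ((s : ℝ) : ℂ) • (Bpᴴ * Bp) +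
            ((q : ℝ) : ℂ) • (Bp * Bpᴴ)) *ᵥ
          fun b => (hAp.eigenvectorUnitary : Matrix (Subtype p) (Subtype p) ℂ) b a) := by
    intro a
    rw [sectorEigenvector, star_sectorExtend_dotProduct_mulVec_sectorExtend, hsub]
  have hw : ∀ a : Subtype p, canonicalWeight β (sectorEigenvalue p A hA) a =
      (∑ b, Real.exp (-(β * hAp.eigenvalues b)))⁻¹ * Real.exp (-(β * hAp.eigenvalues a)) := fun a => rfl
  simp_rw [hterm, hw, mul_assoc, ← Finset.mul_sum]
  exact mul_nonneg (inv_nonneg.2 (Finset.sum_nonneg fun _ _ => (Real.exp_pos _).le))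
    (sum_exp_mul_re_expect_eeb_nonneg hAp Bp β hq)

omit [DecidableEq ι] in
/-- **Stationarity of eigen-mixtures**: for an eigenvector `ψ` of a Hermitian `A` and every
matrix `X`, `⟨ψ, (A X − X A) ψ⟩ = 0`; hence every mixture of eigenvectors of `A` (in particular
the canonical Gibbs state) vanishes on commutators with `A` — the equation-of-motion rows
`ρ([H, X]) = 0` of a thermal state. [cite: FawziFawziScalet2024, Thm. 3.1] -/
theorem star_dotProduct_commutator_mulVec_eq_zero_of_eigenvector {A : Matrix ι ι ℂ} (hA : A.IsHermitian)
    {ψ : ι → ℂ} {E : ℝ} (hψ : A *ᵥ ψ = ((E : ℝ) : ℂ) • ψ) (X : Matrix ι ι ℂ) :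
    star ψ ⬝ᵥ ((A * X - X * A) *ᵥ ψ) = 0 := by
  have h := star_mulVec A ψ
  rw [hA.eq] at h
  have h1 : star ψ ⬝ᵥ (A *ᵥ (X *ᵥ ψ)) = ((E : ℝ) : ℂ) * (star ψ ⬝ᵥ (X *ᵥ ψ)) := by
    rw [dotProduct_mulVec, ← h, hψ, star_smul, smul_dotProduct, smul_eq_mul, Complex.star_def,
      Complex.conj_ofReal]
  have h2 : star ψ ⬝ᵥ (X *ᵥ (A *ᵥ ψ)) = ((E : ℝ) : ℂ) * (star ψ ⬝ᵥ (X *ᵥ ψ)) := by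
    rw [hψ, mulVec_smul, dotProduct_smul, smul_eq_mul]
  rw [sub_mulVec, ← mulVec_mulVec, ← mulVec_mulVec, dotProduct_sub, h1, h2, sub_self]

omit [DecidableEq ι] [DecidablePred p] in
/-- **From invariant subspaces to matrix entries**: if `B` maps the coordinate subspace
`K = {v | v = 0 off p}` into itself, then `B` has no entries from the sector into its complement.
(Test on the coordinate vectors `e_j`, `j ∈ p`.) [cite: Tasaki2020, §2.2] -/
theorem apply_eq_zero_off_of_mulVec_mem (K : Submodule ℂ (ι → ℂ))
    (hK : ∀ v, v ∈ K ↔ ∀ i, ¬ p i → v i = 0) {B : Matrix ι ι ℂ} (hBK : ∀ v ∈ K, B *ᵥ v ∈ K)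
    (i j : ι) (hi : ¬ p i) (hj : p j) : B i j = 0 := by
  classical
  have hej : (Pi.single j (1 : ℂ) : ι → ℂ) ∈ K := by
    refine (hK _).2 fun i' hi' => ?_
    have hne : i' ≠ j := fun h => hi' (h ▸ hj)
    rw [Pi.single_apply, if_neg hne]
  have h := (hK _).1 (hBK _ hej) i hi
  rwa [Matrix.mulVec_single_one, Matrix.col_apply] at h

end CoordinateSector

end Literature.MathematicalPhysics.QuantumLattice

end
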